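import Mathlib
import HarnessLib
import Literature.MathematicalPhysics.StatisticalMechanics.LatticePolynomialFields
import Literature.MathematicalPhysics.StatisticalMechanics.RelevantHamiltonianNorm

/-!
# The Taylor data of a relevant Hamiltonian: `H(B,φ) = |B|a_∅ + ℓ_H(φ) + Q_H(φ,φ)`
# ([ABKM19] Ch. 6.2 / Ch. 8.4, input of the projection `Π₂`)

For `H ∈ M_0(𝓑_k)` (`GradientRG.RelevantHamiltonian 𝕜 d`, `𝕜` a normed field over `ℝ`) and a finite
set of sites `B`, the functional `φ ↦ H(B,φ) = eval H B φ` is a polynomial of degree two in the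
field.  This file makes that structure explicit as continuous (multi)linear maps and computes the
derivatives used by the projection `Π₂` ([ABKM19] Lemma 8.5):
* `iterDiffCLM`, `fwdDiffCLM` — `ξ ↦ ∇^αξ(x)`, `ξ ↦ ∇_iξ(x)` as continuous linear functionals;
* `evalLin H B` (`ℓ_H`), `evalQuad H B` (`Q_H`, bilinear) and **`eval_eq_taylor`**:
  `H(B,φ) = |B| • a_∅ + ℓ_H φ + Q_H φ φ`;
* `hasFDerivAt_eval`, `fderiv_eval_zero` (`DH(B)(0) = ℓ_H`), `iteratedFDeriv_two_eval`
  (`D²H(B)(φ)(ξ,η) = Q_H ξ η + Q_H η ξ`), `contDiff_eval`;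
* the values on the polynomial test fields of `LatticePolynomialFields`: `linSysMat c B` (the matrix
  `B_{α'α} = Σ_{x∈B} b_{α'−α}(x)` of (8.46)–(8.47)), **`evalLin_polyField`**
  (`ℓ_H(b_{α'}) = Σ_α B_{α'α} a_α`) and **`evalQuad_polyField_single`** (`Q_H(b_i,b_j) = |B| a_{ij}` for
  `i ≤ j`, `0` for `i > j`).

Everything is proved; no named fact.

## References
* S. Adams, S. Buchholz, R. Kotecký, S. Müller, arXiv:1910.13564, Ch. 6.2 (relevant Hamiltonians),
  Ch. 8.4 (8.43)–(8.47) [AdamsBuchholzKoteckyMuller2019].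
-/

noncomputable section

namespace Literature.MathematicalPhysics.StatisticalMechanics.GradientRG

open Finset
open Literature.MathematicalPhysics.StatisticalMechanics.GradientFRD (iterDiff)

variable {𝕜 : Type*} [NormedField 𝕜] [NormedAlgebra ℝ 𝕜] {d M : ℕ} [NeZero M]

/-! ## The lattice derivatives at a site as continuous linear functionals -/

/-- `ξ ↦ ∇^α ξ(x)` as a continuous linear functional on field space.
[cite: AdamsBuchholzKoteckyMuller2019, Ch. 6.2 (relevant monomials, linear)] -/
def iterDiffCLM (α : Fin d → ℕ) (x : Fin d → ZMod M) : ((Fin d → ZMod M) → ℝ) →L[ℝ] ℝ :=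
  LinearMap.toContinuousLinearMap ((LinearMap.proj x).comp (iterDiffₗ α))

/-- `iterDiffCLM α x ξ = ∇^αξ(x)`. [cite: AdamsBuchholzKoteckyMuller2019, Ch. 6.2 (relevant monomials, linear)] -/
@[simp] theorem iterDiffCLM_apply (α : Fin d → ℕ) (x : Fin d → ZMod M) (ξ : (Fin d → ZMod M) → ℝ) :
    iterDiffCLM α x ξ = iterDiff α ξ x := rfl

/-- `ξ ↦ ∇_i ξ(x)` as a continuous linear functional on field space.
[cite: AdamsBuchholzKoteckyMuller2019, Ch. 6.2 (relevant monomials, quadratic)] -/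
def fwdDiffCLM (i : Fin d) (x : Fin d → ZMod M) : ((Fin d → ZMod M) → ℝ) →L[ℝ] ℝ :=
  LinearMap.toContinuousLinearMap ((LinearMap.proj i).comp (gradAt x))

/-- `fwdDiffCLM i x ξ = ∇_iξ(x)`. [cite: AdamsBuchholzKoteckyMuller2019, Ch. 6.2 (relevant monomials, quadratic)] -/
@[simp] theorem fwdDiffCLM_apply (i : Fin d) (x : Fin d → ZMod M) (ξ : (Fin d → ZMod M) → ℝ) :
    fwdDiffCLM i x ξ = GradientFRD.fwdDiff i ξ x := rfl

/-! ## The linear and quadratic parts of `H(B, ·)` -/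

/-- **The linear part `ℓ_H` of `H(B,·)`**: `ξ ↦ Σ_{x∈B} Σ_α ∇^αξ(x) a_α`.
[cite: AdamsBuchholzKoteckyMuller2019, Ch. 8.4 (8.45)] -/
def evalLin (H : RelevantHamiltonian 𝕜 d) (B : Finset (Fin d → ZMod M)) :
    ((Fin d → ZMod M) → ℝ) →L[ℝ] 𝕜 :=
  ∑ x ∈ B, ∑ α : linIndex d, (iterDiffCLM (α : Fin d → ℕ) x).smulRight (H (Sum.inr (Sum.inl α)))

/-- **The quadratic part `Q_H` of `H(B,·)`** as a bilinear map:
`(ξ, η) ↦ Σ_{x∈B} Σ_{i≤j} ∇_iξ(x)∇_jη(x) a_{ij}`. [cite: AdamsBuchholzKoteckyMuller2019, Ch. 8.4 (8.43)] -/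
def evalQuad (H : RelevantHamiltonian 𝕜 d) (B : Finset (Fin d → ZMod M)) :
    ((Fin d → ZMod M) → ℝ) →L[ℝ] ((Fin d → ZMod M) → ℝ) →L[ℝ] 𝕜 :=
  ∑ x ∈ B, ∑ q : quadIndex d,
    (fwdDiffCLM q.1.1 x).smulRight ((fwdDiffCLM q.1.2 x).smulRight (H (Sum.inr (Sum.inr q))))

/-- `ℓ_H` evaluated. [cite: AdamsBuchholzKoteckyMuller2019, Ch. 8.4 (8.45)] -/
theorem evalLin_apply (H : RelevantHamiltonian 𝕜 d) (B : Finset (Fin d → ZMod M))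
    (ξ : (Fin d → ZMod M) → ℝ) :
    evalLin H B ξ = ∑ x ∈ B, ∑ α : linIndex d, iterDiff (α : Fin d → ℕ) ξ x • H (Sum.inr (Sum.inl α)) := by
  simp only [evalLin, _root_.sum_apply, ContinuousLinearMap.smulRight_apply, iterDiffCLM_apply]

/-- `Q_H` evaluated. [cite: AdamsBuchholzKoteckyMuller2019, Ch. 8.4 (8.43)] -/
theorem evalQuad_apply (H : RelevantHamiltonian 𝕜 d) (B : Finset (Fin d → ZMod M))
    (ξ η : (Fin d → ZMod M) → ℝ) :
    evalQuad H B ξ η = ∑ x ∈ B, ∑ q : quadIndex d,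
      (GradientFRD.fwdDiff q.1.1 ξ x * GradientFRD.fwdDiff q.1.2 η x) • H (Sum.inr (Sum.inr q)) := by
  simp only [evalQuad, _root_.sum_apply, ContinuousLinearMap.smulRight_apply, fwdDiffCLM_apply,
    _root_.smul_apply, smul_smul]

/-- **`H(B,φ) = |B|·a_∅ + ℓ_H(φ) + Q_H(φ,φ)`.** [cite: AdamsBuchholzKoteckyMuller2019, Ch. 8.4 (8.40)] -/
theorem eval_eq_taylor (H : RelevantHamiltonian 𝕜 d) (B : Finset (Fin d → ZMod M))
    (φ : (Fin d → ZMod M) → ℝ) :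
    eval H B φ = (B.card : ℝ) • H (Sum.inl ()) + evalLin H B φ + evalQuad H B φ φ := by
  rw [evalLin_apply, evalQuad_apply]
  unfold eval density
  simp only [Fintype.sum_sum_type, Finset.univ_unique, Finset.sum_singleton, relMonomial_const,
    one_smul, relMonomial_lin, relMonomial_quad, Finset.sum_add_distrib, Finset.sum_const,
    ← Nat.cast_smul_eq_nsmul ℝ, PUnit.default_eq_unit, add_assoc]

/-! ## Derivatives -/

/-- The derivative of `H(B,·)`: `DH(B)(φ) = ℓ_H + Q_H(φ,·) + Q_H(·,φ)`.
[cite: AdamsBuchholzKoteckyMuller2019, Ch. 8.4 (8.40)] -/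
theorem hasFDerivAt_eval (H : RelevantHamiltonian 𝕜 d) (B : Finset (Fin d → ZMod M))
    (φ : (Fin d → ZMod M) → ℝ) :
    HasFDerivAt (fun ψ : (Fin d → ZMod M) → ℝ => eval H B ψ)
      (evalLin H B + evalQuad H B φ + (evalQuad H B).flip φ) φ := by
  have hfun : (fun ψ : (Fin d → ZMod M) → ℝ => eval H B ψ) =
      (fun _ => (B.card : ℝ) • H (Sum.inl ())) + ⇑(evalLin H B) +
        fun ψ => evalQuad H B ψ ψ := by
    funext ψ; simp only [Pi.add_apply]; exact eval_eq_taylor H B ψ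
  rw [hfun]
  have h3 : HasFDerivAt (fun ψ : (Fin d → ZMod M) → ℝ => evalQuad H B ψ ψ)
      (evalQuad H B φ + (evalQuad H B).flip φ) φ := by
    refine (((evalQuad H B).hasFDerivAt (x := φ)).clm_apply (hasFDerivAt_id φ)).congr_fderiv ?_
    ext ξ
    simp
  exact (((hasFDerivAt_const _ φ).add (evalLin H B).hasFDerivAt).add h3).congr_fderiv
    (by rw [zero_add, add_assoc])

/-- `fderiv` of `H(B,·)`. [cite: AdamsBuchholzKoteckyMuller2019, Ch. 8.4 (8.40)] -/
theorem fderiv_eval (H : RelevantHamiltonian 𝕜 d) (B : Finset (Fin d → ZMod M))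
    (φ : (Fin d → ZMod M) → ℝ) :
    fderiv ℝ (fun ψ : (Fin d → ZMod M) → ℝ => eval H B ψ) φ =
      evalLin H B + evalQuad H B φ + (evalQuad H B).flip φ :=
  (hasFDerivAt_eval H B φ).fderiv

/-- **`DH(B)(0) = ℓ_H`.** [cite: AdamsBuchholzKoteckyMuller2019, Ch. 8.4 (8.41)] -/
theorem fderiv_eval_zero (H : RelevantHamiltonian 𝕜 d) (B : Finset (Fin d → ZMod M)) :
    fderiv ℝ (fun ψ : (Fin d → ZMod M) → ℝ => eval H B ψ) 0 = evalLin H B := by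
  rw [fderiv_eval, map_zero, map_zero, add_zero, add_zero]

/-- The derivative of `φ ↦ DH(B)(φ)` is the constant bilinear map `Q_H + Q_H^t`.
[cite: AdamsBuchholzKoteckyMuller2019, Ch. 8.4 (8.40)] -/
theorem hasFDerivAt_fderiv_eval (H : RelevantHamiltonian 𝕜 d) (B : Finset (Fin d → ZMod M))
    (φ : (Fin d → ZMod M) → ℝ) :
    HasFDerivAt (fun ψ : (Fin d → ZMod M) → ℝ => fderiv ℝ (fun ψ' : (Fin d → ZMod M) → ℝ => eval H B ψ') ψ)
      (evalQuad H B + (evalQuad H B).flip) φ := by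
  have hfun : (fun ψ : (Fin d → ZMod M) → ℝ =>
      fderiv ℝ (fun ψ' : (Fin d → ZMod M) → ℝ => eval H B ψ') ψ) =
      (fun _ => evalLin H B) + ⇑(evalQuad H B + (evalQuad H B).flip) := by
    funext ψ; rw [fderiv_eval, Pi.add_apply, add_apply, add_assoc]
  rw [hfun]
  exact ((hasFDerivAt_const _ φ).add (evalQuad H B + (evalQuad H B).flip).hasFDerivAt).congr_fderiv
    (by rw [zero_add])

/-- **`D²H(B)(φ)(ξ,η) = Q_H(ξ,η) + Q_H(η,ξ)`.** [cite: AdamsBuchholzKoteckyMuller2019, Ch. 8.4 (8.42)] -/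
theorem iteratedFDeriv_two_eval (H : RelevantHamiltonian 𝕜 d) (B : Finset (Fin d → ZMod M))
    (φ ξ η : (Fin d → ZMod M) → ℝ) :
    iteratedFDeriv ℝ 2 (fun ψ : (Fin d → ZMod M) → ℝ => eval H B ψ) φ ![ξ, η] =
      evalQuad H B ξ η + evalQuad H B η ξ := by
  rw [iteratedFDeriv_two_apply, (hasFDerivAt_fderiv_eval H B φ).fderiv]
  simp

/-- `H(B,·)` is smooth. [cite: AdamsBuchholzKoteckyMuller2019, Ch. 6.2 (M_0 ⊂ M(𝓑_k))] -/
theorem contDiff_eval (H : RelevantHamiltonian 𝕜 d) (B : Finset (Fin d → ZMod M)) {n : WithTop ℕ∞} :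
    ContDiff ℝ n (fun ψ : (Fin d → ZMod M) → ℝ => eval H B ψ) := by
  have hfun : (fun ψ : (Fin d → ZMod M) → ℝ => eval H B ψ) =
      fun ψ => (B.card : ℝ) • H (Sum.inl ()) + evalLin H B ψ + evalQuad H B ψ ψ :=
    funext fun ψ => eval_eq_taylor H B ψ
  rw [hfun]
  exact (contDiff_const.add (evalLin H B).contDiff).add
    (((evalQuad H B).contDiff).clm_apply contDiff_id)

/-! ## Values on the polynomial test fields -/

/-- **The matrix of the linear system (8.46)–(8.47)**: `B_{α'α} = Σ_{x∈B} ∇^α b_{α'}(x) =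
Σ_{x∈B} b_{α'−α}(x)` for `α ≤ α'` and `0` otherwise (centre `c`).
[cite: AdamsBuchholzKoteckyMuller2019, Ch. 8.4 (8.47)] -/
def linSysMat (c : Fin d → ZMod M) (B : Finset (Fin d → ZMod M)) :
    Matrix (linIndex d) (linIndex d) ℝ :=
  fun α' α => if (∀ i, (α : Fin d → ℕ) i ≤ (α' : Fin d → ℕ) i)
    then ∑ x ∈ B, polyField c ((α' : Fin d → ℕ) - (α : Fin d → ℕ)) x else 0

omit [NeZero M] in
/-- The diagonal of `B` is `|B|`. [cite: AdamsBuchholzKoteckyMuller2019, Ch. 8.4 (8.48)] -/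
theorem linSysMat_diag (c : Fin d → ZMod M) (B : Finset (Fin d → ZMod M)) (α : linIndex d) :
    linSysMat c B α α = B.card := by
  simp [linSysMat]

omit [NeZero M] in
/-- `B_{α'α} = 0` unless `α ≤ α'`. [cite: AdamsBuchholzKoteckyMuller2019, Ch. 8.4 (8.48)] -/
theorem linSysMat_eq_zero {c : Fin d → ZMod M} {B : Finset (Fin d → ZMod M)} {α' α : linIndex d}
    (h : ¬ ∀ i, (α : Fin d → ℕ) i ≤ (α' : Fin d → ℕ) i) : linSysMat c B α' α = 0 := by
  simp [linSysMat, h]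

/-- **`ℓ_H(b_{α'}) = Σ_α B_{α'α} a_α`** (room for `⌊d/2⌋+1` steps on `B`).
[cite: AdamsBuchholzKoteckyMuller2019, Ch. 8.4 (8.46)] -/
theorem evalLin_polyField {c : Fin d → ZMod M} {B : Finset (Fin d → ZMod M)}
    (hB : ∀ x ∈ B, HasRoom c x (d / 2 + 1)) (H : RelevantHamiltonian 𝕜 d) (α' : linIndex d) :
    evalLin H B (polyField c (α' : Fin d → ℕ)) =
      ∑ α : linIndex d, linSysMat c B α' α • H (Sum.inr (Sum.inl α)) := by
  rw [evalLin_apply, Finset.sum_comm]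
  refine Finset.sum_congr rfl fun α _ => ?_
  rw [← Finset.sum_smul]
  congr 1
  have hdeg : ∑ i, (α : Fin d → ℕ) i ≤ d / 2 + 1 := (mem_linIndex.1 α.2).2
  rw [Finset.sum_congr rfl fun x hx => iterDiff_polyField' (hB x hx) (α' : Fin d → ℕ) α hdeg]
  unfold linSysMat
  split_ifs <;> simp

/-- **`Q_H(b_i, b_j) = |B| a_{ij}` for `i ≤ j`, `= 0` for `i > j`** (room for one step on `B`).
[cite: AdamsBuchholzKoteckyMuller2019, Ch. 8.4 (8.43)] -/
theorem evalQuad_polyField_single {c : Fin d → ZMod M} {B : Finset (Fin d → ZMod M)}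
    (hB : ∀ x ∈ B, HasRoom c x 1) (H : RelevantHamiltonian 𝕜 d) (i j : Fin d) :
    evalQuad H B (polyField c (Pi.single i 1)) (polyField c (Pi.single j 1)) =
      if h : i ≤ j then (B.card : ℝ) • H (Sum.inr (Sum.inr ⟨(i, j), h⟩)) else 0 := by
  rw [evalQuad_apply]
  have hterm : ∀ x ∈ B, ∑ q : quadIndex d,
      (GradientFRD.fwdDiff q.1.1 (polyField c (Pi.single i 1)) x *
        GradientFRD.fwdDiff q.1.2 (polyField c (Pi.single j 1)) x) • H (Sum.inr (Sum.inr q)) =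
      if h : i ≤ j then H (Sum.inr (Sum.inr ⟨(i, j), h⟩)) else 0 := by
    intro x hx
    simp only [fwdDiff_polyField_single (hB x hx)]
    split_ifs with hij
    · rw [Finset.sum_eq_single ⟨(i, j), hij⟩]
      · simp
      · intro q _ hq
        have : ¬ (q.1.1 = i ∧ q.1.2 = j) := by
          intro hcon; apply hq; exact Subtype.ext (Prod.ext hcon.1 hcon.2)
        by_cases h1 : q.1.1 = i
        · have h2 : q.1.2 ≠ j := fun h2 => this ⟨h1, h2⟩
          simp [h1, h2]
        · simp [h1]
      · simp
    · refine Finset.sum_eq_zero fun q _ => ?_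
      by_cases h1 : q.1.1 = i
      · have h2 : q.1.2 ≠ j := by
          intro h2; apply hij; rw [← h1, ← h2]; exact q.2
        simp [h1, h2]
      · simp [h1]
  rw [Finset.sum_congr rfl hterm]
  split_ifs with h
  · rw [Finset.sum_const, ← Nat.cast_smul_eq_nsmul ℝ]
  · simp

end Literature.MathematicalPhysics.StatisticalMechanics.GradientRG

end
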